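/-
COR-CM (cell pub-hodgecm2, stage 2 of the Hodge ladder) — count-neutral KERNEL COMBINATORICS «spectator doubling G = H × ⟨x⟩ (x a CENTRAL involution
outside the index-two subgroup H ∋ c), part VI: the marginal-sum map on the coinvariant fibres — `marg₀ + marg₁` sends `rad2(G) → rad2(H)`, lifts to their
`H`-faces and mixed faces to `0`; hence lifts of a fibre-independent `H`-family together with any fibre-independent family of mixed faces are fibre-independent»
(seat prover-pub-hodgecm2-b23-g47-0, binder prover b23, gen 47; claim «SPECTATOR DOUBLING», HOME/INBOX.md l.21993).  Theorems only (no definition), on top of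
part I `Census/SpectatorSquares` and b09ʼs `Census/CoinvariantFibre` (`red`, `rad2`), `Census/TwoAdicSplitting` (pivot criterion, parity ⟹ fibre
independence), `Census/BaseBlockCovering` (`par_gface_apply`) BY NAME; no `decide`, no certificate, no named fact, no `sorry`;
`Interfaces.lean` (C1), every E term, B01, `Transposition/*`, `PortJoin/*`, `D2Bridge/*` untouched.
HONEST FRAMING: `HC_CM` is NOT proved, here or anywhere in the tree; nothing here is a period, a count of record or a headline.
T5: n/a-class (hypothesis binders: `c * c = 1`, `c` central, `c ∈ H`, `H.index = 2`, `x ∉ H`, `x * x = 1`, `x` central); checker: self.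
-/
import Summits.HodgeConjecture.CorCM.Census.SpectatorSquares
import Summits.HodgeConjecture.CorCM.Census.TwoAdicSplitting
import Summits.HodgeConjecture.CorCM.Census.BaseBlockCovering

/-!
# Spectator doubling `G = H × ⟨x⟩`, VI: the marginal sum on the coinvariant fibres

THE SETTING of parts I–V (`x` central, `x·x = 1`, `x ∉ H ∋ c`).  The coinvariant fibre of `(G, c)` is `hodge2 / rad2` with `rad2 = pair2 + aug2` (b09ʼs
`Census/CoinvariantFibre`); a family of integer vectors is FIBRE-INDEPENDENT if its classes `(rad2).mkQ ∘ red` are linearly independent over `𝔽₂`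
(the currency of b09ʼs `Census/TwoAdicSplitting`: a fibre-independent family generating after inverting `2` extends to a law `μ = φ₂` for `2`-groups).

* §1 The mod-`2` marginal sum `φ = (res₀)_* + (res₁)_*` on `𝔽₂[types of G]`: `φ ∘ red = red ∘ (marg₀ + marg₁)` (`msum_red`); it commutes with base change
  along `H` and is INVARIANT under base change along the central `x` (the swap; `msum_mapDomain_rt_coe`, `msum_mapDomain_rt_x`).
* §2 **`φ(rad2(G)) ≤ rad2(H)`** (`rad2_le_comap_msum`): pairs go to sums of two pairs, a face of `G` goes to a face of `H` or to `0`
  (`marg_sum_face`), so coboundaries go to coboundaries.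
* §3 **THE FIBRE-INDEPENDENCE CRITERION** (`fibreIndep_lifts_union_mixed`): if `S` is fibre-independent in `(H, c)`, `L f` is a lift of `f` (`marg₀ (L f) = f`,
  `marg₁ (L f) = 0`) for `f ∈ S`, and `M` is a fibre-independent family of bi-marginal-zero vectors of `(G, c)` (e.g. mixed faces), then `L '' S ∪ M` is
  fibre-independent in `(G, c)`.  Numerically (design note `HOME/pub-hodgecm2-b23/SPECTATOR.md` §3b) the lifts of an `H`-generating family together with
  ONE distance-lowering mixed face per far block have fibre rank EXACTLY `|S| + #far` in all thirteen cases computed, and a closing family of parallel faces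
  must supply the remaining `φ₂(G) − φ₂(H) − #far = #nbr − [|H|/2 odd]` classes (parts III–IV); in every case computed the fibre-spanning such families are
  exactly the generating ones.
* §4 **One distance-lowering mixed face per far block is fibre-independent** (`fibreIndep_desc_faces`): parity-independent by b09ʼs pivot criterion with
  pivot = own block and rank = distance (the three other corners of a distance-lowering face lie in blocks of smaller distance).  Hence
  (`fibreIndep_lifts_union_desc`) **the lifts of a fibre-independent `S` together with one distance-lowering mixed face at each far-block representative are
  fibre-independent** — `|S| + #far` independent fibre classes, the observed count.

## References
* [Pohlmann1968] H. Pohlmann, Algebraic cycles on abelian varieties of complex multiplication type, Ann. of Math. 88 (1968), Thm 1.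
-/

namespace Summit.HodgeConjecture.CorCM.Census.Spectator

open Finset
open Summit.HodgeConjecture.CorCM.Prior.AllgGroup.RfwfAllgGroup
open Summit.HodgeConjecture.CorCM.Census.BlockParity
open Summit.HodgeConjecture.CorCM.Census.Coinvariant
open Summit.HodgeConjecture.CorCM.Census.ComplementFaces
open Summit.HodgeConjecture.CorCM.Census.IndexTwoDescent
open Summit.HodgeConjecture.CorCM.Census.Splitting
open Summit.HodgeConjecture.CorCM.Census.BaseBlock

noncomputable section

variable {G : Type*} [Group G] [Fintype G] [DecidableEq G] {c : G}
variable {H : Subgroup G} [DecidablePred (· ∈ H)]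

/-! ## §1 The mod-2 marginal sum -/

/-- `red ∘ marg₀ = (res₀)_* ∘ red`. [folklore] -/
theorem red_marg₀ (hcH : c ∈ H) (y : CMF G c →₀ ℤ) :
    red (⟨c, hcH⟩ : H) (marg₀ hcH y) = Finsupp.mapDomain (res₀ hcH) (red c y) := by
  rw [red_apply, red_apply, marg₀, Finsupp.lmapDomain_apply]
  exact (Finsupp.mapDomain_mapRange _ y (fun n : ℤ => (n : ZMod 2)) Int.cast_zero (fun a b => Int.cast_add a b)).symm

/-- `red ∘ marg₁ = (res₁)_* ∘ red`. [folklore] -/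
theorem red_marg₁ (hcH : c ∈ H) (hcen : ∀ g : G, g * c = c * g) (x : G) (y : CMF G c →₀ ℤ) :
    red (⟨c, hcH⟩ : H) (marg₁ hcH hcen x y) = Finsupp.mapDomain (res₁ hcH hcen x) (red c y) := by
  rw [red_apply, red_apply, marg₁, Finsupp.lmapDomain_apply]
  exact (Finsupp.mapDomain_mapRange _ y (fun n : ℤ => (n : ZMod 2)) Int.cast_zero (fun a b => Int.cast_add a b)).symm

/-- **`φ ∘ red = red ∘ (marg₀ + marg₁)`** for the mod-`2` marginal sum `φ = (res₀)_* + (res₁)_*`. [folklore] -/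
theorem msum_red (hcH : c ∈ H) (hcen : ∀ g : G, g * c = c * g) (x : G) (y : CMF G c →₀ ℤ) :
    (Finsupp.lmapDomain (ZMod 2) (ZMod 2) (res₀ hcH) + Finsupp.lmapDomain (ZMod 2) (ZMod 2) (res₁ hcH hcen x)) (red c y) =
      red (⟨c, hcH⟩ : H) (marg₀ hcH y + marg₁ hcH hcen x y) := by
  rw [LinearMap.add_apply, Finsupp.lmapDomain_apply, Finsupp.lmapDomain_apply, map_add, red_marg₀, red_marg₁]

/-- **The marginal sum commutes with base change along `H`.** [folklore] -/
theorem msum_mapDomain_rt_coe (hcH : c ∈ H) (hcen : ∀ g : G, g * c = c * g) (x : G) (h : H) (v : CMF G c →₀ ZMod 2) :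
    (Finsupp.lmapDomain (ZMod 2) (ZMod 2) (res₀ hcH) + Finsupp.lmapDomain (ZMod 2) (ZMod 2) (res₁ hcH hcen x))
        (Finsupp.mapDomain (rt c (h : G)) v) =
      Finsupp.mapDomain (rt (⟨c, hcH⟩ : H) h)
        ((Finsupp.lmapDomain (ZMod 2) (ZMod 2) (res₀ hcH) + Finsupp.lmapDomain (ZMod 2) (ZMod 2) (res₁ hcH hcen x)) v) := by
  simp only [LinearMap.add_apply, Finsupp.lmapDomain_apply, Finsupp.mapDomain_add, ← Finsupp.mapDomain_comp]
  have e0 : res₀ hcH ∘ rt c (h : G) = rt (⟨c, hcH⟩ : H) h ∘ res₀ hcH := funext fun Ψ => res₀_rt_coe hcH h Ψ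
  have e1 : res₁ hcH hcen x ∘ rt c (h : G) = rt (⟨c, hcH⟩ : H) h ∘ res₁ hcH hcen x := funext fun Ψ => res₁_rt_coe hcH hcen x h Ψ
  rw [e0, e1]

/-- **The marginal sum is invariant under base change along the central `x`** (the two marginals swap). [folklore] -/
theorem msum_mapDomain_rt_x (hcH : c ∈ H) (hcen : ∀ g : G, g * c = c * g) {x : G} (hxx : x * x = 1) (hxc : ∀ g : G, g * x = x * g)
    (v : CMF G c →₀ ZMod 2) :
    (Finsupp.lmapDomain (ZMod 2) (ZMod 2) (res₀ hcH) + Finsupp.lmapDomain (ZMod 2) (ZMod 2) (res₁ hcH hcen x))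
        (Finsupp.mapDomain (rt c x) v) =
      (Finsupp.lmapDomain (ZMod 2) (ZMod 2) (res₀ hcH) + Finsupp.lmapDomain (ZMod 2) (ZMod 2) (res₁ hcH hcen x)) v := by
  simp only [LinearMap.add_apply, Finsupp.lmapDomain_apply, ← Finsupp.mapDomain_comp]
  have e0 : res₀ hcH ∘ rt c x = res₁ hcH hcen x := funext fun Ψ => res₀_rt_x hcH hcen hxc Ψ
  have e1 : res₁ hcH hcen x ∘ rt c x = res₀ hcH := funext fun Ψ => res₁_rt_x hcH hcen hxx hxc Ψ
  rw [e0, e1, add_comm]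

/-! ## §2 `φ(rad2(G)) ≤ rad2(H)` -/

/-- **A face of `G` has marginal sum a face of `H` or `0`**: both places in `H` — the face on the `0`-side; both in `xH` — on the `1`-side; mixed — `0`.
[folklore] -/
theorem marg_sum_face (hcH : c ∈ H) (hcen : ∀ g : G, g * c = c * g) (hc2 : c * c = 1) (hH : H.index = 2) {x : G} (hx : x ∉ H)
    {f : CMF G c →₀ ℤ} (hf : f ∈ gfaceSet G c hc2) :
    marg₀ hcH f + marg₁ hcH hcen x f = 0 ∨ marg₀ hcH f + marg₁ hcH hcen x f ∈ gfaceSet H ⟨c, hcH⟩ (csub_mul_csub hcH hc2) := by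
  classical
  obtain ⟨Θ, s, t, hst, rfl⟩ := hf
  by_cases hs : s ∈ H <;> by_cases ht : t ∈ H
  · obtain ⟨s', rfl⟩ : ∃ s' : H, (s' : G) = s := ⟨⟨s, hs⟩, rfl⟩
    obtain ⟨t', rfl⟩ : ∃ t' : H, (t' : G) = t := ⟨⟨t, ht⟩, rfl⟩
    right
    rw [marg₀_gface_coe_coe, marg₁_gface_coe_coe hcH hcen hc2 hx, add_zero]
    exact ⟨_, s', t', fun h => hst ((coe_mem_orb_coe_iff hcH s' t').mpr h), rfl⟩
  · obtain ⟨s', rfl⟩ : ∃ s' : H, (s' : G) = s := ⟨⟨s, hs⟩, rfl⟩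
    obtain ⟨t', rfl⟩ := exists_eq_mul_of_not_mem hH hx ht
    left
    rw [marg₀_gface_coe_mul hcH hcen hc2 hx, marg₁_gface_coe_mul hcH hcen hc2 hx, add_zero]
  · obtain ⟨s', rfl⟩ := exists_eq_mul_of_not_mem hH hx hs
    obtain ⟨t', rfl⟩ : ∃ t' : H, (t' : G) = t := ⟨⟨t, ht⟩, rfl⟩
    left
    rw [gface_comm, marg₀_gface_coe_mul hcH hcen hc2 hx, marg₁_gface_coe_mul hcH hcen hc2 hx, add_zero]
  · obtain ⟨s', rfl⟩ := exists_eq_mul_of_not_mem hH hx hs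
    obtain ⟨t', rfl⟩ := exists_eq_mul_of_not_mem hH hx ht
    right
    rw [marg₀_gface_mul_mul hcH hcen hc2 hx, marg₁_gface_mul_mul, zero_add]
    exact ⟨_, s', t', fun h => hst ((mul_coe_mem_orb_mul_iff hcH hcen x s' t').mpr h), rfl⟩

/-- **`φ(rad2(G)) ≤ rad2(H)`**: the mod-`2` marginal sum carries pairs to sums of pairs and coboundaries of faces to coboundaries of faces (or `0`),
because it commutes with base change along `H` and is invariant under base change along the central `x`. [folklore] -/
theorem rad2_le_comap_msum (hcH : c ∈ H) (hcen : ∀ g : G, g * c = c * g) (hc2 : c * c = 1) (hH : H.index = 2) {x : G} (hx : x ∉ H)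
    (hxx : x * x = 1) (hxc : ∀ g : G, g * x = x * g) :
    rad2 c hc2 ≤ (rad2 (⟨c, hcH⟩ : H) (csub_mul_csub hcH hc2)).comap
      (Finsupp.lmapDomain (ZMod 2) (ZMod 2) (res₀ hcH) + Finsupp.lmapDomain (ZMod 2) (ZMod 2) (res₁ hcH hcen x)) := by
  have hc2' := csub_mul_csub hcH hc2
  set φ := Finsupp.lmapDomain (ZMod 2) (ZMod 2) (res₀ hcH) + Finsupp.lmapDomain (ZMod 2) (ZMod 2) (res₁ hcH hcen x) with hφ
  -- the marginal sum of the reduction of a face of `G`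
  have hface : ∀ v ∈ faces2 c hc2, φ v = 0 ∨ φ v ∈ faces2 (⟨c, hcH⟩ : H) hc2' := by
    rintro _ ⟨f, hf, rfl⟩
    rw [hφ, msum_red]
    rcases marg_sum_face hcH hcen hc2 hH hx hf with h0 | hF
    · left; rw [h0, map_zero]
    · right; exact ⟨_, hF, rfl⟩
  refine sup_le ?_ ?_
  · -- pairs
    rw [pair2, Submodule.span_le]
    rintro _ ⟨p, hp, rfl⟩
    obtain ⟨Ψ, rfl⟩ : ∃ Ψ, pair c Ψ = p := hp
    show φ (red c (pair c Ψ)) ∈ rad2 (⟨c, hcH⟩ : H) hc2'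
    rw [hφ, msum_red, marg₀_pair, marg₁_pair, map_add]
    exact Submodule.add_mem _ (pair2_le_rad2 _ hc2' (Submodule.subset_span ⟨_, pair_mem_pairSet _ _, rfl⟩))
      (pair2_le_rad2 _ hc2' (Submodule.subset_span ⟨_, pair_mem_pairSet _ _, rfl⟩))
  · -- coboundaries
    rw [aug2, Submodule.span_le]
    rintro _ ⟨Q, v, hv, rfl⟩
    show φ (Finsupp.mapDomain (rt c Q) v - v) ∈ rad2 (⟨c, hcH⟩ : H) hc2'
    -- `φ (v·Q⁻¹) = (φ v)·h⁻¹` for `Q = h` or `Q = x h`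
    obtain ⟨h, hh⟩ : ∃ h : H, φ (Finsupp.mapDomain (rt c Q) v) = Finsupp.mapDomain (rt (⟨c, hcH⟩ : H) h) (φ v) := by
      by_cases hQ : Q ∈ H
      · exact ⟨⟨Q, hQ⟩, msum_mapDomain_rt_coe hcH hcen x ⟨Q, hQ⟩ v⟩
      · obtain ⟨q, rfl⟩ := exists_eq_mul_of_not_mem hH hx hQ
        refine ⟨q, ?_⟩
        rw [mapDomain_rt_mul, hφ, msum_mapDomain_rt_x hcH hcen hxx hxc, msum_mapDomain_rt_coe]
    rw [map_sub, hh]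
    rcases hface v hv with h0 | hF
    · rw [h0, Finsupp.mapDomain_zero, sub_zero]; exact Submodule.zero_mem _
    · exact le_sup_right (b := aug2 _ hc2') (Submodule.subset_span ⟨h, φ v, hF, rfl⟩)

/-! ## §3 The fibre-independence criterion -/

/-- **THE FIBRE-INDEPENDENCE CRITERION FOR THE SPECTATOR DOUBLING.**  Let `S` be a fibre-independent family of `(H, c)`, `L f` a lift of `f`
(`marg₀ (L f) = f`, `marg₁ (L f) = 0`) for every `f ∈ S`, and `M` a fibre-independent family of bi-marginal-zero vectors of `(G, c)` (for instance mixed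
faces).  Then `L '' S ∪ M` is fibre-independent in `(G, c)`: the mod-`2` marginal sum descends to the fibres, maps the class of `L f` to the class of `f`
and kills `M`. [folklore] -/
theorem fibreIndep_lifts_union_mixed (hcH : c ∈ H) (hcen : ∀ g : G, g * c = c * g) (hc2 : c * c = 1) (hH : H.index = 2) {x : G}
    (hx : x ∉ H) (hxx : x * x = 1) (hxc : ∀ g : G, g * x = x * g)
    (S : Set (CMF H ⟨c, hcH⟩ →₀ ℤ))
    (hS : LinearIndepOn (ZMod 2) (fun f : CMF H ⟨c, hcH⟩ →₀ ℤ =>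
      (rad2 (⟨c, hcH⟩ : H) (csub_mul_csub hcH hc2)).mkQ (red (⟨c, hcH⟩ : H) f)) S)
    (L : (CMF H ⟨c, hcH⟩ →₀ ℤ) → (CMF G c →₀ ℤ)) (hL : ∀ f ∈ S, marg₀ hcH (L f) = f ∧ marg₁ hcH hcen x (L f) = 0)
    (M : Set (CMF G c →₀ ℤ)) (hM : ∀ m ∈ M, marg₀ hcH m = 0 ∧ marg₁ hcH hcen x m = 0)
    (hMi : LinearIndepOn (ZMod 2) (fun F : CMF G c →₀ ℤ => (rad2 c hc2).mkQ (red c F)) M) :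
    LinearIndepOn (ZMod 2) (fun F : CMF G c →₀ ℤ => (rad2 c hc2).mkQ (red c F)) (L '' S ∪ M) := by
  classical
  have hc2' := csub_mul_csub hcH hc2
  set φ := Finsupp.lmapDomain (ZMod 2) (ZMod 2) (res₀ hcH) + Finsupp.lmapDomain (ZMod 2) (ZMod 2) (res₁ hcH hcen x) with hφ
  set v : (CMF G c →₀ ℤ) → (CMF G c →₀ ZMod 2) ⧸ rad2 c hc2 := fun F => (rad2 c hc2).mkQ (red c F) with hv
  set vH : (CMF H ⟨c, hcH⟩ →₀ ℤ) → (CMF H ⟨c, hcH⟩ →₀ ZMod 2) ⧸ rad2 (⟨c, hcH⟩ : H) hc2' :=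
    fun f => (rad2 (⟨c, hcH⟩ : H) hc2').mkQ (red (⟨c, hcH⟩ : H) f) with hvH
  -- the descended map
  set mbar := (rad2 c hc2).mapQ (rad2 (⟨c, hcH⟩ : H) hc2') φ (rad2_le_comap_msum hcH hcen hc2 hH hx hxx hxc) with hmbar
  have hmv : ∀ F : CMF G c →₀ ℤ, mbar (v F) = vH (marg₀ hcH F + marg₁ hcH hcen x F) := by
    intro F
    show mbar ((rad2 c hc2).mkQ (red c F)) = (rad2 (⟨c, hcH⟩ : H) hc2').mkQ (red (⟨c, hcH⟩ : H) (marg₀ hcH F + marg₁ hcH hcen x F))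
    rw [Submodule.mkQ_apply, Submodule.mkQ_apply, hmbar, Submodule.mapQ_apply, ← msum_red]
  -- on lifts `mbar ∘ v ∘ L = vH`, on `M` `mbar ∘ v = 0`
  have hlift : ∀ f ∈ S, (mbar ∘ v) (L f) = vH f := by
    intro f hf
    rw [Function.comp_apply, hmv, (hL f hf).1, (hL f hf).2, add_zero]
  have hkill : ∀ m ∈ M, mbar (v m) = 0 := by
    intro m hm
    rw [hmv, (hM m hm).1, (hM m hm).2, add_zero, hvH]
    simp only [map_zero]
  -- (1) the lifts are fibre-independent
  have h1 : LinearIndepOn (ZMod 2) (mbar ∘ v) (L '' S) := by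
    refine LinearIndepOn.image_of_comp L (mbar ∘ v) ?_
    exact hS.congr fun f hf => (hlift f hf).symm
  have h1' : LinearIndepOn (ZMod 2) v (L '' S) := h1.of_comp mbar
  -- (2) disjointness of the two spans: `mbar` is injective on the first and kills the second
  have hdj : Disjoint (Submodule.span (ZMod 2) (v '' (L '' S))) (Submodule.span (ZMod 2) (v '' M)) := by
    rw [Submodule.disjoint_def]
    intro w hw1 hw2
    have hw0 : mbar w = 0 := by
      have hle : Submodule.span (ZMod 2) (v '' M) ≤ LinearMap.ker mbar := by
        rw [Submodule.span_le]
        rintro _ ⟨m, hm, rfl⟩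
        exact LinearMap.mem_ker.mpr (hkill m hm)
      exact LinearMap.mem_ker.mp (hle hw2)
    obtain ⟨l, hl, rfl⟩ := (Finsupp.mem_span_image_iff_linearCombination (ZMod 2)).mp hw1
    have hcomb : Finsupp.linearCombination (ZMod 2) (mbar ∘ v) l = 0 := by
      rw [← Finsupp.apply_linearCombination (ZMod 2) mbar v l, hw0]
    have hl0 : l = 0 := (linearIndepOn_iff.mp h1) l hl hcomb
    rw [hl0, map_zero]
  exact h1'.union hMi hdj

/-! ## §4 One distance-lowering mixed face per far block is fibre-independent -/

/-- A corner of smaller distance lies in another block. [folklore] -/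
theorem blk_ne_of_wt_lt (hcH : c ∈ H) (hcen : ∀ g : G, g * c = c * g) (hc2 : c * c = 1) (hH : H.index = 2) {x : G} (hx : x ∉ H)
    (hxx : x * x = 1) {Φ Ψ : CMF G c}
    (h : wt (⟨c, hcH⟩ : H) (res₁ hcH hcen x Φ) (res₀ hcH Φ) < wt (⟨c, hcH⟩ : H) (res₁ hcH hcen x Ψ) (res₀ hcH Ψ)) :
    blk c Φ ≠ blk c Ψ := fun e => by
  have := wt_res_eq_of_blk_eq hcH hcen hc2 hH hx hxx e
  omega

/-- **The distance-lowering mixed faces at the far-block representatives are PARITY-independent** (pivot = own block, rank = distance).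
[folklore] -/
theorem parityIndep_desc_faces (hcH : c ∈ H) (hcen : ∀ g : G, g * c = c * g) (hc2 : c * c = 1) (hH : H.index = 2) {x : G} (hx : x ∉ H)
    (hxx : x * x = 1) (rep : Block c → CMF G c) (hrep : ∀ b : Block c, blk c (rep b) = b) (d d' : Block c → H)
    (hdev : ∀ b : Block c, 2 ≤ wt (⟨c, hcH⟩ : H) (res₁ hcH hcen x (rep b)) (res₀ hcH (rep b)) →
      d b ∈ (res₁ hcH hcen x (rep b)).1 ∧ d b ∉ (res₀ hcH (rep b)).1 ∧ d' b ∈ (res₁ hcH hcen x (rep b)).1 ∧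
      d' b ∉ (res₀ hcH (rep b)).1 ∧ d b ≠ d' b) :
    LinearIndepOn (ZMod 2) (fun F : CMF G c →₀ ℤ => par c F)
      ((fun b : Block c => gface c hc2 (rep b) (d b : G) (x * (d' b : G))) ''
        {b : Block c | 2 ≤ wt (⟨c, hcH⟩ : H) (res₁ hcH hcen x (rep b)) (res₀ hcH (rep b))}) := by
  classical
  set D : CMF G c → ℕ := fun Ψ => wt (⟨c, hcH⟩ : H) (res₁ hcH hcen x Ψ) (res₀ hcH Ψ) with hD
  set face : Block c → (CMF G c →₀ ℤ) := fun b => gface c hc2 (rep b) (d b : G) (x * (d' b : G)) with hface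
  -- parities of a block face: `1` at its own block, `0` at other blocks of higher-or-equal distance
  have hcorners : ∀ b : Block c, 2 ≤ D (rep b) →
      D (oflipCM c hc2 (d b : G) (rep b)) < D (rep b) ∧ D (oflipCM c hc2 (x * (d' b : G)) (rep b)) < D (rep b) ∧
      D (oflipCM c hc2 (d b : G) (oflipCM c hc2 (x * (d' b : G)) (rep b))) < D (rep b) := by
    intro b hb
    obtain ⟨hd1, hd0, hd'1, hd'0, hne⟩ := hdev b hb
    obtain ⟨e1, e2, e3⟩ := descends_of_devs hcH hcen hc2 hx (rep b) hd1 hd0 hd'1 hd'0 hne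
    refine ⟨?_, ?_, ?_⟩ <;> simp only [hD] <;> omega
  have hself : ∀ b : Block c, 2 ≤ D (rep b) → par c (face b) b = 1 := by
    intro b hb
    obtain ⟨h1, h2, h3⟩ := hcorners b hb
    have n1 := blk_ne_of_wt_lt hcH hcen hc2 hH hx hxx h1
    have n2 := blk_ne_of_wt_lt hcH hcen hc2 hH hx hxx h2
    have n3 := blk_ne_of_wt_lt hcH hcen hc2 hH hx hxx h3
    rw [hrep] at n1 n2 n3
    show par c (gface c hc2 (rep b) (d b : G) (x * (d' b : G))) b = 1
    rw [par_gface_apply, hrep, if_pos rfl, if_neg n3, if_neg n1, if_neg n2]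
    ring
  have hother : ∀ b : Block c, 2 ≤ D (rep b) → ∀ b' : Block c, b' ≠ b → D (rep b) ≤ D (rep b') → par c (face b) b' = 0 := by
    intro b hb b' hb' hle
    obtain ⟨h1, h2, h3⟩ := hcorners b hb
    have hne : ∀ {Φ : CMF G c}, D Φ < D (rep b) → blk c Φ ≠ b' := fun {Φ} hΦ e => by
      have := wt_res_eq_of_blk_eq hcH hcen hc2 hH hx hxx (e.trans (hrep b').symm)
      simp only [hD] at hΦ hle; omega
    show par c (gface c hc2 (rep b) (d b : G) (x * (d' b : G))) b' = 0
    rw [par_gface_apply, hrep, if_neg (Ne.symm hb'), if_neg (hne h3), if_neg (hne h1), if_neg (hne h2)]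
    ring
  -- distinct blocks give distinct faces
  have hinj : Set.InjOn face {b : Block c | 2 ≤ D (rep b)} := by
    intro b₁ hb₁ b₂ hb₂ heq
    by_contra hne
    rcases le_total (D (rep b₁)) (D (rep b₂)) with hle | hle
    · have h0 := hother b₁ hb₁ b₂ (Ne.symm hne) hle
      rw [heq, hself b₂ hb₂] at h0
      exact one_ne_zero h0
    · have h0 := hother b₂ hb₂ b₁ hne hle
      rw [← heq, hself b₁ hb₁] at h0
      exact one_ne_zero h0
  -- pivot criterion on the image, pulled back to the blocks
  have key : LinearIndepOn (ZMod 2) ((fun F : CMF G c →₀ ℤ => par c F) ∘ face) {b : Block c | 2 ≤ D (rep b)} := by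
    refine linearIndepOn_of_pivot (fun b => par c (face b)) _ (fun b => b) (fun b => D (rep b)) ?_ ?_
    · intro b hb; rw [hself b hb]; exact one_ne_zero
    · intro b hb b' hb' hbb' hle; exact hother b hb b' (Ne.symm hbb') hle
  exact key.image_of_comp face (fun F : CMF G c →₀ ℤ => par c F)

/-- **Hence they are FIBRE-independent.** [folklore] -/
theorem fibreIndep_desc_faces (hcH : c ∈ H) (hcen : ∀ g : G, g * c = c * g) (hc2 : c * c = 1) (hH : H.index = 2) {x : G} (hx : x ∉ H)
    (hxx : x * x = 1) (rep : Block c → CMF G c) (hrep : ∀ b : Block c, blk c (rep b) = b) (d d' : Block c → H)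
    (hdev : ∀ b : Block c, 2 ≤ wt (⟨c, hcH⟩ : H) (res₁ hcH hcen x (rep b)) (res₀ hcH (rep b)) →
      d b ∈ (res₁ hcH hcen x (rep b)).1 ∧ d b ∉ (res₀ hcH (rep b)).1 ∧ d' b ∈ (res₁ hcH hcen x (rep b)).1 ∧
      d' b ∉ (res₀ hcH (rep b)).1 ∧ d b ≠ d' b) :
    LinearIndepOn (ZMod 2) (fun F : CMF G c →₀ ℤ => (rad2 c hc2).mkQ (red c F))
      ((fun b : Block c => gface c hc2 (rep b) (d b : G) (x * (d' b : G))) ''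
        {b : Block c | 2 ≤ wt (⟨c, hcH⟩ : H) (res₁ hcH hcen x (rep b)) (res₀ hcH (rep b))}) :=
  fibreIndep_of_parityIndep c hc2 _ (parityIndep_desc_faces hcH hcen hc2 hH hx hxx rep hrep d d' hdev)

/-- **THE FIBRE ACCOUNTING OF THE SPECTATOR DOUBLING**: the lifts of a fibre-independent family `S` of `(H, c)` together with one distance-lowering mixed
face at every far-block representative are fibre-independent in `(G, c)` — `|S| + #{far blocks}` independent classes in the coinvariant fibre, so that a
closing family must supply the remaining `φ₂(G, c) − |S| − #{far blocks}` classes (`= #{neighbour blocks} − [|H|/2 odd]` when `|S| = φ₂(H, c)`,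
parts III–IV). [folklore] -/
theorem fibreIndep_lifts_union_desc (hcH : c ∈ H) (hcen : ∀ g : G, g * c = c * g) (hc2 : c * c = 1) (hH : H.index = 2) {x : G}
    (hx : x ∉ H) (hxx : x * x = 1) (hxc : ∀ g : G, g * x = x * g)
    (S : Set (CMF H ⟨c, hcH⟩ →₀ ℤ))
    (hS : LinearIndepOn (ZMod 2) (fun f : CMF H ⟨c, hcH⟩ →₀ ℤ =>
      (rad2 (⟨c, hcH⟩ : H) (csub_mul_csub hcH hc2)).mkQ (red (⟨c, hcH⟩ : H) f)) S)
    (L : (CMF H ⟨c, hcH⟩ →₀ ℤ) → (CMF G c →₀ ℤ)) (hL : ∀ f ∈ S, marg₀ hcH (L f) = f ∧ marg₁ hcH hcen x (L f) = 0)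
    (rep : Block c → CMF G c) (hrep : ∀ b : Block c, blk c (rep b) = b) (d d' : Block c → H)
    (hdev : ∀ b : Block c, 2 ≤ wt (⟨c, hcH⟩ : H) (res₁ hcH hcen x (rep b)) (res₀ hcH (rep b)) →
      d b ∈ (res₁ hcH hcen x (rep b)).1 ∧ d b ∉ (res₀ hcH (rep b)).1 ∧ d' b ∈ (res₁ hcH hcen x (rep b)).1 ∧
      d' b ∉ (res₀ hcH (rep b)).1 ∧ d b ≠ d' b) :
    LinearIndepOn (ZMod 2) (fun F : CMF G c →₀ ℤ => (rad2 c hc2).mkQ (red c F))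
      (L '' S ∪ (fun b : Block c => gface c hc2 (rep b) (d b : G) (x * (d' b : G))) ''
        {b : Block c | 2 ≤ wt (⟨c, hcH⟩ : H) (res₁ hcH hcen x (rep b)) (res₀ hcH (rep b))}) := by
  refine fibreIndep_lifts_union_mixed hcH hcen hc2 hH hx hxx hxc S hS L hL _ ?_
    (fibreIndep_desc_faces hcH hcen hc2 hH hx hxx rep hrep d d' hdev)
  rintro _ ⟨b, -, rfl⟩
  exact ⟨marg₀_gface_coe_mul hcH hcen hc2 hx _ _ _, marg₁_gface_coe_mul hcH hcen hc2 hx _ _ _⟩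

end

end Summit.HodgeConjecture.CorCM.Census.Spectator
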